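import Literature.Computability.QuantumComplexity.CliffordTPathSums
import HarnessLib

/-!
# Exact state-vector simulation of Clifford+`T` circuits over `ℤ[ω]`: the dynamic programme

Topic `Literature/Computability/QuantumComplexity`, continuing `CliffordTPathSums.lean`
(`pathStep`, `stepVec`, `semZeta_mulVec_basisState`: one Clifford+`T` gate maps a basis state to
a two-term sum over a choice bit; `prodZeta`, `probAcc`, `hCount`). The amplitudes of a
Clifford+`T` circuit started on a basis state lie in `2^{-h/2} ℤ[ω]` (`ω = e^{iπ/4}`, `h` the
number of Hadamard gates so far), so the state vector can be propagated **exactly** gate by gate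
with integer arithmetic on the four coordinates of `a₀ + a₁ω + a₂ω² + a₃ω³` — the brute-force
("Schrödinger") simulation, polynomial in the number of gates and in the number `|Λ|` of basis
labels carried. This file is the machine-independent specification of that simulation, in the
exact shape computed by the polynomial-time machine of the sequel (which realises the language
level of Markov–Shi's Cor. 1.5 on the light cone of the measured wire, `LightCone.lean`):

* `ZW = Fin 4 → ℤ` with `zwVal a = Σ aᵢ ωⁱ`, `mulOmega` (`· ω`: `(a₀,a₁,a₂,a₃) ↦ (−a₃,a₀,a₁,a₂)`),
  `mulOmegaPow`, and the **norm form** `‖zwVal a‖² = zwU a + zwV a · √2` with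
  `zwU = Σ aᵢ²`, `zwV = a₀a₁ + a₁a₂ + a₂a₃ − a₃a₀` (`normSq_zwVal`);
* the DP over a list of labels `labs`: `contrib g w z a` (the two choice bits of `pathStep`,
  phases reduced mod `8` as the machine does), `dpStep`, `dpRun`, `dpInit`; its **correctness**
  `dpRun_spec`: if `labs` enumerates without repetition a set of labels closed under the steps of
  the (oracle-free) gates and containing the start label `w₀`, then for every label `z`,
  `zwVal (dpRun gs labs (dpInit w₀) z) = √2^{h} · ⟨z| prodZeta ω gs |w₀⟩`, and amplitudes vanish
  off the set;
* the acceptance statistic: `accU`, `accV` (sums of `zwU`, `zwV` over the labels with wire `0`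
  set) with `2^h · probAcc = accU + accV √2` (`two_pow_mul_probAcc`), and the exact **sign test**
  `posSqrtTwoTest a b ↔ 0 < a + b√2` on integers (`posSqrtTwoTest_iff`), whence
  `probAcc > 1/2 ↔ posSqrtTwoTest (2 accU − 2^h) (2 accV)` (`half_lt_probAcc_iff`).

## References

* M. A. Nielsen, I. L. Chuang, *Quantum Computation and Quantum Information*, CUP 2010, §4.2
  (actions of `H`, `S`, `T`, `CNOT`), §4.5.5 (classical simulation by storing the `2ⁿ` amplitudes),
  §2.2.5 (Born rule).
* I. L. Markov, Y. Shi, *Simulating quantum computation by contracting tensor networks*, SIAM J.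
  Comput. 38 (2008) 963–981, §1 ("one may use a naïve brute-force calculation of quantum
  amplitudes", deterministic simulation = exact outcome probabilities).
* B. Giles, P. Selinger, *Exact synthesis of multiqubit Clifford+T circuits*, Phys. Rev. A 87
  (2013) 032332, §3 (Clifford+`T` matrix entries lie in `ℤ[1/√2, i] = ⋃ₖ 2^{-k/2} ℤ[ω]`); here
  only the elementary direction "gates preserve `2^{-h/2}ℤ[ω]`" is used, and it is proved.
-/

noncomputable section

namespace Literature.Computability.QuantumComplexity

open _root_.Computability Complexity Cryptography Matrix

/-! ### The ring `ℤ[ω]` by coordinates -/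

/-- Coordinates of an element `a₀ + a₁ω + a₂ω² + a₃ω³` of `ℤ[ω]`, `ω = e^{iπ/4}`. [folklore] -/
abbrev ZW : Type := Fin 4 → ℤ

namespace ZW

/-- The complex value `Σ aᵢ ωⁱ`. [folklore] -/
def zwVal (a : ZW) : ℂ := ∑ i : Fin 4, (a i : ℂ) * omega ^ (i : ℕ)

/-- `zwVal` spelled out. [folklore] -/
theorem zwVal_eq (a : ZW) : zwVal a = a 0 + a 1 * omega + a 2 * omega ^ 2 + a 3 * omega ^ 3 := by
  simp [zwVal, Fin.sum_univ_four]

/-- `zwVal` is additive. [folklore] -/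
@[simp] theorem zwVal_add (a b : ZW) : zwVal (a + b) = zwVal a + zwVal b := by
  simp [zwVal, Finset.sum_add_distrib, add_mul]

/-- `zwVal 0 = 0`. [folklore] -/
@[simp] theorem zwVal_zero : zwVal 0 = 0 := by simp [zwVal]

/-- The unit `1 = (1, 0, 0, 0)`. [folklore] -/
def one : ZW := ![1, 0, 0, 0]

/-- `zwVal 1 = 1`. [folklore] -/
@[simp] theorem zwVal_one : zwVal one = 1 := by simp [zwVal_eq, one]

/-- **Multiplication by `ω`**: `(a₀,a₁,a₂,a₃) ↦ (−a₃,a₀,a₁,a₂)` (`ω⁴ = −1`). [folklore] -/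
def mulOmega (a : ZW) : ZW := ![-a 3, a 0, a 1, a 2]

/-- `zwVal (mulOmega a) = ω · zwVal a`. [folklore] -/
@[simp] theorem zwVal_mulOmega (a : ZW) : zwVal (mulOmega a) = omega * zwVal a := by
  simp only [zwVal_eq, mulOmega, Matrix.cons_val_zero, Matrix.cons_val_one, Matrix.cons_val,
    Int.cast_neg]
  have h4 : omega ^ 4 = -1 := omega_pow_four
  linear_combination (-(a 3 : ℂ)) * h4

/-- `mulOmega` is additive. [folklore] -/
theorem mulOmega_add (a b : ZW) : mulOmega (a + b) = mulOmega a + mulOmega b := by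
  ext i
  fin_cases i <;> simp [mulOmega, add_comm]

/-- `zwVal` of a list sum is the sum of the values. [folklore] -/
theorem zwVal_list_sum {α : Type*} (l : List α) (f : α → ZW) :
    zwVal (l.map f).sum = (l.map fun x => zwVal (f x)).sum := by
  induction l with
  | nil => simp
  | cons x l ih => simp [ih]

/-- `mulOmega 0 = 0`. [folklore] -/
@[simp] theorem mulOmega_zero : mulOmega 0 = 0 := by
  ext i; fin_cases i <;> simp [mulOmega]

/-- Multiplication by `ω^k`. [folklore] -/
def mulOmegaPow (k : ℕ) (a : ZW) : ZW := mulOmega^[k] a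

/-- `zwVal (mulOmegaPow k a) = ω^k · zwVal a`. [folklore] -/
@[simp] theorem zwVal_mulOmegaPow (k : ℕ) (a : ZW) : zwVal (mulOmegaPow k a) = omega ^ k * zwVal a := by
  induction k with
  | zero => simp [mulOmegaPow]
  | succ k ih =>
    rw [mulOmegaPow, Function.iterate_succ_apply', zwVal_mulOmega, ← mulOmegaPow, ih, pow_succ]
    ring

/-- `mulOmegaPow k 0 = 0`. [folklore] -/
@[simp] theorem mulOmegaPow_zero_right (k : ℕ) : mulOmegaPow k (0 : ZW) = 0 := by
  induction k with
  | zero => rfl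
  | succ k ih => rw [mulOmegaPow, Function.iterate_succ_apply', ← mulOmegaPow, ih, mulOmega_zero]

/-- The rational part `Σ aᵢ²` of `|a|²`. [folklore] -/
def zwU (a : ZW) : ℤ := a 0 * a 0 + a 1 * a 1 + a 2 * a 2 + a 3 * a 3

/-- The `√2`-part `a₀a₁ + a₁a₂ + a₂a₃ − a₃a₀` of `|a|²`. [folklore] -/
def zwV (a : ZW) : ℤ := a 0 * a 1 + a 1 * a 2 + a 2 * a 3 - a 3 * a 0

/-- **The norm form of `ℤ[ω]`**: `|a₀ + a₁ω + a₂ω² + a₃ω³|² = zwU a + zwV a · √2`. [folklore] -/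
theorem normSq_zwVal (a : ZW) : ‖zwVal a‖ ^ 2 = (zwU a : ℝ) + zwV a * Real.sqrt 2 := by
  have hs : Real.sqrt 2 * Real.sqrt 2 = 2 := Real.mul_self_sqrt (by norm_num)
  have hre : (zwVal a).re = a 0 + (a 1 - a 3) * (Real.sqrt 2 / 2) := by
    rw [zwVal_eq, show omega ^ 3 = omega ^ 2 * omega by ring, omega_pow_two]
    simp [omega_re, omega_im]
    ring
  have him : (zwVal a).im = a 2 + (a 1 + a 3) * (Real.sqrt 2 / 2) := by
    rw [zwVal_eq, show omega ^ 3 = omega ^ 2 * omega by ring, omega_pow_two]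
    simp [omega_re, omega_im]
    ring
  rw [Complex.sq_norm, Complex.normSq_apply, hre, him, zwU, zwV]
  push_cast
  linear_combination (((a 1 : ℝ) - a 3) ^ 2 + ((a 1 : ℝ) + a 3) ^ 2) / 4 * hs

end ZW

open ZW

/-! ### The dynamic programme -/

variable {N : ℕ}

/-- The contribution of the source label `w` with choice bit `c` to the target label `z` through
the gate `g`, acting on the source amplitude `a`: `ω^{φ mod 8} · a` if the path step is valid and
lands on `z`, else `0`. [cite: NielsenChuang2010, §4.2] -/
def contribBit (g : QGate cliffordT N) (c : Bool) (w z : QReg N) (a : ZW) : ZW :=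
  match pathStep g c w with
  | some (w', ψ) => if w' = z then mulOmegaPow (ψ % 8) a else 0
  | none => 0

/-- Both choice bits. [folklore] -/
def contrib (g : QGate cliffordT N) (w z : QReg N) (a : ZW) : ZW :=
  contribBit g false w z a + contribBit g true w z a

/-- **One gate of the DP**: the new amplitude of `z` is the sum over the carried labels `w` of
their contributions. [cite: NielsenChuang2010, §4.5.5] -/
def dpStep (g : QGate cliffordT N) (labs : List (QReg N)) (T : QReg N → ZW) : QReg N → ZW :=
  fun z => (labs.map fun w => contrib g w z (T w)).sum

/-- **The whole DP** through a gate list (head = first gate). [cite: NielsenChuang2010, §4.5.5] -/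
def dpRun : List (QGate cliffordT N) → List (QReg N) → (QReg N → ZW) → (QReg N → ZW)
  | [], _, T => T
  | g :: gs, labs, T => dpRun gs labs (dpStep g labs T)

/-- The initial table: the basis state `|w₀⟩`. [folklore] -/
def dpInit (w₀ : QReg N) : QReg N → ZW := fun z => if z = w₀ then ZW.one else 0

/-- `contribBit` on the zero amplitude vanishes. [folklore] -/
@[simp] theorem contribBit_zero (g : QGate cliffordT N) (c : Bool) (w z : QReg N) :
    contribBit g c w z 0 = 0 := by
  unfold contribBit
  rcases pathStep g c w with _ | ⟨w', ψ⟩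
  · rfl
  · simp

/-- The value of a contribution: `[step valid, lands on z] · ω^φ · value`. [folklore] -/
theorem zwVal_contribBit (g : QGate cliffordT N) (c : Bool) (w z : QReg N) (a : ZW) :
    zwVal (contribBit g c w z a) =
      (match pathStep g c w with
        | some (w', ψ) => if w' = z then omega ^ ψ else 0
        | none => 0) * zwVal a := by
  unfold contribBit
  rcases pathStep g c w with _ | ⟨w', ψ⟩
  · simp
  · simp only
    split_ifs
    · rw [zwVal_mulOmegaPow, omega_pow_mod_eight]
    · simp

/-- The coordinate `z` of a step vector: `hCoef · ω^φ · [z = target]`. [folklore] -/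
theorem stepVec_apply (g : QGate cliffordT N) (c : Bool) (w z : QReg N) :
    stepVec omega g c w z =
      hCoef g * (match pathStep g c w with
        | some (w', ψ) => if w' = z then omega ^ ψ else 0
        | none => 0) := by
  unfold stepVec
  rcases pathStep g c w with _ | ⟨w', ψ⟩
  · simp
  · simp only [Pi.smul_apply, basisState_apply, smul_eq_mul]
    by_cases h : w' = z
    · subst h; simp
    · simp [h, Ne.symm h]

/-- `√2 · (1/√2) = 1` in `ℂ`. [folklore] -/
theorem sqrt2_mul_invSqrt2 : ((Real.sqrt 2 : ℝ) : ℂ) * invSqrt2 = 1 := by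
  have h : ((Real.sqrt 2 : ℝ) : ℂ) ≠ 0 := by
    rw [Ne, Complex.ofReal_eq_zero]; positivity
  simp only [invSqrt2]
  field_simp

/-- The Hadamard normalisation: `√2^{[g = H]} · hCoef g = 1`. [folklore] -/
theorem sqrt2_pow_mul_hCoef (g : QGate cliffordT N) :
    ((Real.sqrt 2 : ℝ) : ℂ) ^ (if QGateIsH g then 1 else 0) * hCoef g = 1 := by
  unfold hCoef
  split_ifs
  · rw [pow_one, sqrt2_mul_invSqrt2]
  · simp

section Spec

variable (Λ : Set (QReg N)) (labs : List (QReg N))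

/-- The invariant of the DP: amplitudes vanish off `Λ`, and on every label the table holds
`√2^h` times the amplitude. [folklore] -/
def DPInv (T : QReg N → ZW) (v : QReg N → ℂ) (h : ℕ) : Prop :=
  (∀ z, z ∉ Λ → v z = 0) ∧ ∀ z, zwVal (T z) = ((Real.sqrt 2 : ℝ) : ℂ) ^ h * v z

variable {Λ labs}

/-- A sum over the enumerating list is the sum over all labels of a function vanishing off `Λ`.
[folklore] -/
theorem list_sum_eq_univ_sum (hnd : labs.Nodup) (hmem : ∀ w, w ∈ labs ↔ w ∈ Λ) {β : Type*}
    [AddCommMonoid β] (f : QReg N → β) (hf : ∀ w, w ∉ Λ → f w = 0) :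
    (labs.map f).sum = ∑ w, f w := by
  classical
  rw [← List.sum_toFinset _ hnd]
  refine (Finset.sum_subset (Finset.subset_univ _) fun w _ hw => hf w ?_)
  rw [List.mem_toFinset] at hw
  exact fun h => hw ((hmem w).2 h)

/-- **One DP step is one gate.** [cite: NielsenChuang2010, §4.2 and §4.5.5] -/
theorem dpInv_dpStep (hnd : labs.Nodup) (hmem : ∀ w, w ∈ labs ↔ w ∈ Λ) {g : QGate cliffordT N}
    (hg : g.IsOracleFree)
    (hclosed : ∀ c w, w ∈ Λ → ∀ w' ψ, pathStep g c w = some (w', ψ) → w' ∈ Λ)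
    {T : QReg N → ZW} {v : QReg N → ℂ} {h : ℕ} (hT : DPInv Λ T v h) :
    DPInv Λ (dpStep g labs T) (semZeta omega g *ᵥ v) (h + if QGateIsH g then 1 else 0) := by
  classical
  obtain ⟨hoff, hval⟩ := hT
  -- the new state as a double sum
  have hv' : ∀ z, (semZeta omega g *ᵥ v) z = ∑ w, v w * ∑ c : Bool, stepVec omega g c w z := by
    intro z
    have hdec : v = ∑ w, v w • basisState w := by
      funext y
      simp [Finset.sum_apply, basisState_apply, Pi.smul_apply]
    conv_lhs => rw [hdec]
    rw [Matrix.mulVec_sum, Finset.sum_apply]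
    refine Finset.sum_congr rfl fun w _ => ?_
    rw [Matrix.mulVec_smul, semZeta_mulVec_basisState omega_pow_two hg w, Pi.smul_apply,
      smul_eq_mul, Finset.sum_apply]
  refine ⟨fun z hz => ?_, fun z => ?_⟩
  · rw [hv']
    refine Finset.sum_eq_zero fun w _ => ?_
    by_cases hw : w ∈ Λ
    · rw [Fintype.sum_bool, stepVec_apply, stepVec_apply]
      have h0 : ∀ c, (match pathStep g c w with
          | some (w', ψ) => if w' = z then omega ^ ψ else 0
          | none => (0 : ℂ)) = 0 := by
        intro c
        rcases hps : pathStep g c w with _ | ⟨w', ψ⟩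
        · rfl
        · simp only
          rw [if_neg]
          rintro rfl
          exact hz (hclosed c w hw _ _ hps)
      rw [h0, h0]; simp
    · rw [hoff w hw, zero_mul]
  · -- value of the DP step
    rw [hv', dpStep, Finset.mul_sum]
    have hf : ∀ w, w ∉ Λ → zwVal (contrib g w z (T w)) = 0 := by
      intro w hw
      have hTw : T w = 0 ∨ zwVal (T w) = 0 := Or.inr (by rw [hval w, hoff w hw, mul_zero])
      rw [contrib, zwVal_add, zwVal_contribBit, zwVal_contribBit]
      rcases hTw with h0 | h0
      · rw [h0, zwVal_zero]; simp
      · rw [h0]; simp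
    rw [zwVal_list_sum, list_sum_eq_univ_sum hnd hmem (fun w => zwVal (contrib g w z (T w))) hf]
    refine Finset.sum_congr rfl fun w _ => ?_
    rw [contrib, zwVal_add, zwVal_contribBit, zwVal_contribBit, hval w, Fintype.sum_bool,
      stepVec_apply, stepVec_apply, pow_add]
    have hc := sqrt2_pow_mul_hCoef g
    set s := ((Real.sqrt 2 : ℝ) : ℂ) with hs
    set e := s ^ (if QGateIsH g then 1 else 0) with he
    -- both sides are linear in the two bracket terms
    set A := (match pathStep g true w with
        | some (w', ψ) => if w' = z then omega ^ ψ else 0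
        | none => (0 : ℂ)) with hA
    set B := (match pathStep g false w with
        | some (w', ψ) => if w' = z then omega ^ ψ else 0
        | none => (0 : ℂ)) with hB
    calc B * (s ^ h * v w) + A * (s ^ h * v w) = (e * hCoef g) * ((A + B) * (s ^ h * v w)) := by
          rw [hc]; ring
      _ = s ^ h * e * (v w * (hCoef g * A + hCoef g * B)) := by ring

/-- **Correctness of the DP.** If `labs` enumerates `Λ` without repetition, `Λ` is closed under
the path steps of the oracle-free gates `gs`, and the table satisfies the invariant for the
state `v` with `h` Hadamards so far, then after the run it satisfies the invariant for
`prodZeta ω gs · v` with `h + hCount gs` Hadamards. [cite: NielsenChuang2010, §4.5.5] -/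
theorem dpInv_dpRun (hnd : labs.Nodup) (hmem : ∀ w, w ∈ labs ↔ w ∈ Λ) :
    ∀ (gs : List (QGate cliffordT N)), (∀ g ∈ gs, g.IsOracleFree) →
      (∀ g ∈ gs, ∀ c w, w ∈ Λ → ∀ w' ψ, pathStep g c w = some (w', ψ) → w' ∈ Λ) →
      ∀ {T : QReg N → ZW} {v : QReg N → ℂ} {h : ℕ}, DPInv Λ T v h →
        DPInv Λ (dpRun gs labs T) (prodZeta omega gs *ᵥ v) (h + hCount gs) := by
  intro gs
  induction gs with
  | nil => intro _ _ T v h hT; simpa [dpRun] using hT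
  | cons g gs ih =>
    intro hof hcl T v h hT
    have h1 := dpInv_dpStep hnd hmem (hof g (by simp)) (hcl g (by simp)) hT
    have h2 := ih (fun g' hg' => hof g' (by simp [hg'])) (fun g' hg' => hcl g' (by simp [hg'])) h1
    rw [dpRun, prodZeta_cons, ← Matrix.mulVec_mulVec, hCount_cons,
      show h + (hCount gs + (if QGateIsH g then 1 else 0)) = (h + (if QGateIsH g then 1 else 0)) + hCount gs by
        omega]
    exact h2

/-- The initial table satisfies the invariant for `|w₀⟩` (`w₀ ∈ Λ`). [folklore] -/
theorem dpInv_dpInit {w₀ : QReg N} (hw₀ : w₀ ∈ Λ) : DPInv Λ (dpInit w₀) (basisState w₀) 0 := by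
  refine ⟨fun z hz => ?_, fun z => ?_⟩
  · rw [basisState_apply, if_neg]
    rintro rfl
    exact hz hw₀
  · simp only [dpInit, basisState_apply, pow_zero, one_mul]
    split_ifs <;> simp

/-- **The DP computes the amplitudes**: `zwVal (table z) = √2^h ⟨z|U|w₀⟩`.
[cite: NielsenChuang2010, §4.5.5] -/
theorem dpRun_spec (hnd : labs.Nodup) (hmem : ∀ w, w ∈ labs ↔ w ∈ Λ) (gs : List (QGate cliffordT N))
    (hof : ∀ g ∈ gs, g.IsOracleFree)
    (hcl : ∀ g ∈ gs, ∀ c w, w ∈ Λ → ∀ w' ψ, pathStep g c w = some (w', ψ) → w' ∈ Λ)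
    {w₀ : QReg N} (hw₀ : w₀ ∈ Λ) (z : QReg N) :
    zwVal (dpRun gs labs (dpInit w₀) z) =
      ((Real.sqrt 2 : ℝ) : ℂ) ^ hCount gs * (prodZeta omega gs *ᵥ basisState w₀) z := by
  have h := (dpInv_dpRun hnd hmem gs hof hcl (dpInv_dpInit hw₀)).2 z
  rwa [zero_add] at h

end Spec

/-! ### The acceptance statistic and its sign -/

/-- The rational part of `2^h · P[wire 0 = 1]`: `Σ_{z ∈ labs, z₀ = 1} zwU (T z)`. [folklore] -/
def accU (labs : List (QReg N)) (T : QReg N → ZW) : ℤ :=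
  (labs.map fun z => if (∃ h : 0 < N, z ⟨0, h⟩ = true) then zwU (T z) else 0).sum

/-- The `√2`-part of `2^h · P[wire 0 = 1]`: `Σ_{z ∈ labs, z₀ = 1} zwV (T z)`. [folklore] -/
def accV (labs : List (QReg N)) (T : QReg N → ZW) : ℤ :=
  (labs.map fun z => if (∃ h : 0 < N, z ⟨0, h⟩ = true) then zwV (T z) else 0).sum

/-- Casting two integer list sums into `ℝ` and combining them termwise. [folklore] -/
theorem cast_sum_add_cast_sum_mul {α : Type*} (l : List α) (f g : α → ℤ) (r : ℝ) :
    ((l.map f).sum : ℝ) + ((l.map g).sum : ℝ) * r = (l.map fun z => (f z : ℝ) + g z * r).sum := by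
  induction l with
  | nil => simp
  | cons a l ih =>
    simp only [List.map_cons, List.sum_cons, Int.cast_add]
    rw [← ih]
    ring

/-- **`2^h · probAcc = accU + accV √2`** for the table of the DP. [cite: NielsenChuang2010, §2.2.5] -/
theorem two_pow_mul_probAcc {Λ : Set (QReg N)} {labs : List (QReg N)} (hnd : labs.Nodup)
    (hmem : ∀ w, w ∈ labs ↔ w ∈ Λ) (gs : List (QGate cliffordT N)) (hof : ∀ g ∈ gs, g.IsOracleFree)
    (hcl : ∀ g ∈ gs, ∀ c w, w ∈ Λ → ∀ w' ψ, pathStep g c w = some (w', ψ) → w' ∈ Λ)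
    {w₀ : QReg N} (hw₀ : w₀ ∈ Λ) (hN : 0 < N) :
    (2 : ℝ) ^ hCount gs * probAcc omega gs w₀ hN =
      accU labs (dpRun gs labs (dpInit w₀)) + accV labs (dpRun gs labs (dpInit w₀)) * Real.sqrt 2 := by
  classical
  set T := dpRun gs labs (dpInit w₀) with hT
  have hinv := dpInv_dpRun hnd hmem gs hof hcl (dpInv_dpInit hw₀)
  rw [zero_add] at hinv
  have hamp : ∀ z, (2 : ℝ) ^ hCount gs * ‖(prodZeta omega gs *ᵥ basisState w₀) z‖ ^ 2 =
      zwU (T z) + zwV (T z) * Real.sqrt 2 := by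
    intro z
    rw [← normSq_zwVal, hinv.2 z, norm_mul, mul_pow, Complex.norm_pow, Complex.norm_real,
      Real.norm_of_nonneg (Real.sqrt_nonneg _), ← pow_mul, mul_comm (hCount gs) 2, pow_mul,
      Real.sq_sqrt (by norm_num : (0 : ℝ) ≤ 2)]
  set F : QReg N → ℝ := fun z =>
    if (∃ h : 0 < N, z ⟨0, h⟩ = true) then (zwU (T z) : ℝ) + zwV (T z) * Real.sqrt 2 else 0 with hF
  have hoff : ∀ z, z ∉ Λ → F z = 0 := by
    intro z hz
    simp only [hF]
    rw [← hamp z, hinv.1 z hz]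
    simp
  rw [probAcc, Finset.mul_sum, accU, accV, cast_sum_add_cast_sum_mul]
  have hfun : (labs.map fun z =>
      ((if (∃ h : 0 < N, z ⟨0, h⟩ = true) then zwU (T z) else 0 : ℤ) : ℝ) +
        ((if (∃ h : 0 < N, z ⟨0, h⟩ = true) then zwV (T z) else 0 : ℤ) : ℝ) * Real.sqrt 2) = labs.map F :=
    List.map_congr_left fun z _ => by
      by_cases hz : ∃ h : 0 < N, z ⟨0, h⟩ = true
      · simp [hF, hz]
      · simp [hF, hz]
  rw [hfun, list_sum_eq_univ_sum hnd hmem F hoff]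
  refine Finset.sum_congr rfl fun z _ => ?_
  by_cases hz : z ⟨0, hN⟩ = true
  · simp only [hF]
    rw [if_pos hz, if_pos ⟨hN, hz⟩, hamp]
  · simp only [hF]
    rw [if_neg hz, if_neg (fun ⟨_, h'⟩ => hz h'), mul_zero]

/-- **The exact sign test for `a + b√2 > 0`** on integers:
positive iff `a > 0` and (`b ≥ 0` or `2b² < a²`), or `a ≤ 0 ≤ b` and `a² < 2b²`. [folklore] -/
def posSqrtTwoTest (a b : ℤ) : Bool :=
  (decide (0 < a) && (decide (0 ≤ b) || decide (2 * b * b < a * a))) ||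
    (decide (a ≤ 0) && (decide (0 ≤ b) && decide (a * a < 2 * b * b)))

/-- **Correctness of the sign test.** [folklore] -/
theorem posSqrtTwoTest_iff (a b : ℤ) : posSqrtTwoTest a b = true ↔ (0 : ℝ) < a + b * Real.sqrt 2 := by
  have hs : Real.sqrt 2 * Real.sqrt 2 = 2 := Real.mul_self_sqrt (by norm_num)
  have hs0 : 0 < Real.sqrt 2 := by positivity
  simp only [posSqrtTwoTest, Bool.or_eq_true, Bool.and_eq_true, decide_eq_true_eq]
  constructor
  · rintro (⟨ha, hb | hb⟩ | ⟨ha, hb, hab⟩)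
    · have : (0 : ℝ) < a := by exact_mod_cast ha
      have : (0 : ℝ) ≤ b := by exact_mod_cast hb
      positivity
    · have ha' : (0 : ℝ) < a := by exact_mod_cast ha
      have hb' : (2 * b * b : ℝ) < a * a := by exact_mod_cast hb
      by_contra hcon
      push Not at hcon
      -- then -b√2 ≥ a > 0, so 2b² ≥ a²
      have h1 : (a : ℝ) ≤ -b * Real.sqrt 2 := by linarith
      have h2 : (0 : ℝ) ≤ -b * Real.sqrt 2 := le_trans ha'.le h1
      nlinarith [mul_le_mul h1 h1 ha'.le h2]
    · have ha' : (a : ℝ) ≤ 0 := by exact_mod_cast ha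
      have hb' : (0 : ℝ) ≤ b := by exact_mod_cast hb
      have hab' : (a * a : ℝ) < 2 * b * b := by exact_mod_cast hab
      by_contra hcon
      push Not at hcon
      -- then b√2 ≤ -a with both sides nonnegative, so 2b² ≤ a²
      have h1 : (b : ℝ) * Real.sqrt 2 ≤ -a := by linarith
      have h2 : (0 : ℝ) ≤ b * Real.sqrt 2 := by positivity
      nlinarith [mul_le_mul h1 h1 h2 (by linarith)]
  · intro hpos
    by_cases ha : 0 < a
    · left
      refine ⟨ha, ?_⟩
      by_cases hb : 0 ≤ b
      · exact Or.inl hb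
      · right
        push Not at hb
        have hb' : (b : ℝ) < 0 := by exact_mod_cast hb
        have ha' : (0 : ℝ) < a := by exact_mod_cast ha
        -- a > -b√2 > 0
        have h1 : -(b : ℝ) * Real.sqrt 2 < a := by linarith
        have h2 : (0 : ℝ) < -b * Real.sqrt 2 := by nlinarith
        have h3 : (-(b : ℝ) * Real.sqrt 2) * (-b * Real.sqrt 2) < a * a := mul_lt_mul'' h1 h1 h2.le h2.le
        have : (2 * b * b : ℝ) < a * a := by nlinarith [h3]
        exact_mod_cast this
    · right
      push Not at ha
      have ha' : (a : ℝ) ≤ 0 := by exact_mod_cast ha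
      have hb : (0 : ℝ) < b * Real.sqrt 2 := by linarith
      have hb0 : 0 ≤ b := by
        by_contra hcon
        push Not at hcon
        have : (b : ℝ) < 0 := by exact_mod_cast hcon
        nlinarith
      refine ⟨ha, hb0, ?_⟩
      have h1 : -(a : ℝ) < b * Real.sqrt 2 := by linarith
      have h2 : (0 : ℝ) ≤ -a := by linarith
      have h3 : (-(a : ℝ)) * (-a) < (b * Real.sqrt 2) * (b * Real.sqrt 2) := mul_lt_mul'' h1 h1 h2 h2
      have : (a * a : ℝ) < 2 * b * b := by nlinarith [h3]
      exact_mod_cast this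

/-- **Deciding acceptance exactly**: with `U = accU`, `V = accV` of the DP table and `h` the number
of Hadamard gates, `probAcc > 1/2 ↔ posSqrtTwoTest (2U − 2^h) (2V)`.
[cite: MarkovShi2008, §1 (deterministic simulation outputs the exact probability)] -/
theorem half_lt_probAcc_iff {Λ : Set (QReg N)} {labs : List (QReg N)} (hnd : labs.Nodup)
    (hmem : ∀ w, w ∈ labs ↔ w ∈ Λ) (gs : List (QGate cliffordT N)) (hof : ∀ g ∈ gs, g.IsOracleFree)
    (hcl : ∀ g ∈ gs, ∀ c w, w ∈ Λ → ∀ w' ψ, pathStep g c w = some (w', ψ) → w' ∈ Λ)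
    {w₀ : QReg N} (hw₀ : w₀ ∈ Λ) (hN : 0 < N) :
    1 / 2 < probAcc omega gs w₀ hN ↔
      posSqrtTwoTest (2 * accU labs (dpRun gs labs (dpInit w₀)) - 2 ^ hCount gs)
        (2 * accV labs (dpRun gs labs (dpInit w₀))) = true := by
  have h := two_pow_mul_probAcc hnd hmem gs hof hcl hw₀ hN
  have h2 : (0 : ℝ) < (2 : ℝ) ^ hCount gs := by positivity
  rw [posSqrtTwoTest_iff]
  push_cast
  constructor
  · intro hp
    nlinarith [h, h2, hp]
  · intro hp
    by_contra hcon
    push Not at hcon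
    nlinarith [h, h2, hp, hcon, mul_le_mul_of_nonneg_left hcon h2.le]

end Literature.Computability.QuantumComplexity

end
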